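/-
Copyright (c) 2026 the pub-hodgecm-mathlib formalisation cell (harness21).  Prover seat hodgecm-mathlib-LH4-p13 (g10), req620 Track A «(D-RAM) FOUR-FRAME» squad
F0∕P3c∕LH4; the (β₂) road (R-36), β₂ WORD #22 (2) of the sub-dealer LH4-p04 (g9): «THE LABEL LAW — ON THE CLEAN SHELL EVERY VERTEX IS LABELLED ±», dealt by first
refusal to this seat — FILE 2 of 2, the LAW; helper lane on h413 = stmt-HodgeConjecture-24833 (count-neutral).  2026-09-05.
-/
import Summits.HodgeConjecture.HodgeConjecture.Theorems.F0P3cDyRamRankOneSkewValueSet      -- ★ FILE 1 (this seat): §1 `adjugate_*`, `gram_add_map_transpose_eq`; §2 `v_mul_apply_le`, `v_pivotMinor_le_of_adjugate`; §3 `exists_rayScalar_setOf_eq_of_pivotMinors`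
import Summits.HodgeConjecture.HodgeConjecture.Theorems.F0P3cDyRamStageOneBDefs            -- ★ DEFS: `mcOfRecord`; brings ★ census DEFS (`LatticeInLevel`, `LatticeNearTransvShell`), ★ №3 Pieces (`valueSetMod`, `xPlus`, `mstarOfRecord`)
import Summits.HodgeConjecture.HodgeConjecture.Theorems.F0P3cDyRamCleanELetterRamM          -- ★ p862630 (LH4-p16 (g2)) §1: `exists_fixed_unit_sub_mul_refSkew_le_any`; brings ★ `v_refSkew_eq`, `valueSetMod_smul_xPlus_eq_of_v_sub_le_pred`
import Summits.HodgeConjecture.HodgeConjecture.Theorems.F0P3cDyRamSmulXPlusLabel             -- ★ (LH4-p13 (g7)): `valueSetMod_smul_xPlus` (the letter `a ↦ e·t₊·N(a)` of `e • X₊`)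
import Literature.NumberTheory.Automorphic.UnitaryLatticeTreeFixedCosetStrataDictionary     -- ★ `map_toLin'_mapGL_stdLattice_le_scaleLattice_iff` (level tokens in a basis); brings ★ `mapGL_latt_eq_latt_iff`, ★ `pairing_mulVec_mulVec`
import Literature.NumberTheory.Automorphic.UnitaryLatticeTreeTypes                         -- ★ `isIntMatrix_nonsing_inv_of_v_det_eq_one`; brings ★ `CartanUnique.v_adjugate_apply_le_one`
import Literature.NumberTheory.Automorphic.UnitaryGroupFormTransport                       -- ★ `conj_mem_unitaryGroupOfForm_iff`, `formCongr`
import HarnessLib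

/-!
# Crux `H413`, line LH4 «(D-RAM) FOUR-FRAME» — the (β₂) road (R-36), β₂ WORD #22 (2): «THE LABEL LAW — ON THE CLEAN SHELL EVERY VERTEX IS LABELLED `±`», as a
# FRAME-FREE LATTICE THEOREM: at ANY self-dual vertex `L` of ANY non-degenerate hermitian form `H`, fixed by a unitary `Γ ≡ 1 (mod ϖ^{m_c})` on the near-transvection
# shell `(ℓ₀, m_c)`, the `ϖ^{m*}`-value set of `Γ − 1` on `L` is `valueSetMod σ ϖ m* (e′ • X₊)` for a `σ`-FIXED UNIT `e′`

Cell `hodgecm-mathlib` (D-0151), FLOOR 0, crux item H413 = `stmt-HodgeConjecture-24833`, route of record `HCCMUnconditional`; squad F0∕P3c∕LH4; lane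
`--supports stmt-HodgeConjecture-24833 --as helper` (count-neutral; pays NO tier-0 row).  THEOREMS ONLY (no `def`, no instance, no notation, no `sorry`, default heartbeats);
★-only imports; states NO census law; (β₂) and the (OFF) residue stay HYPOTHESES of their holders.

THE STATEMENT (β₂ sub-dealer LH4-p04 (g9) WORD #22 (2); REF5 R5-3 (C) as a theorem; (OFF) lead LH7-p09 (g2) BETA2-OFF-RESIDUAL v1 §2∕§4 (3b) «what is missing in the MIX
band»).  `(σ, ϖ, d, t)` a ramified quadratic datum with `d ≥ 2`, `ℓ₀ = d % 2`, `m* = mstarOfRecord d = ℓ₀ + 2d − 1`, `m_c = mcOfRecord d = ℓ₀ + 3d − 2`; `H` a hermitian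
`3 × 3` matrix (`(σH)ᵀ = H`), `L` a SELF-DUAL vertex for `H` (★ `IsSelfDualLattice`), `Γ ∈ U(σ, H)` with `Γ·L = L`, `X = Γ − 1` on the CLEAN SHELL at `L`
(★ census DEFS `LatticeNearTransvShell ϖ ℓ₀ m_c X L`: `X·L ⊆ ϖ^{ℓ₀}L`, `X·L ⊄ ϖ^{ℓ₀+1}L`, `X²·L ⊆ ϖ^{m_c}L`) and the FENCE `Γ ≡ 1 (mod ϖ^n)` in the standard frame, `n ≥ m_c`.
THEN there is a `σ`-fixed unit `e′` with `{⟨y, Xy⟩_H : y ∈ L} + ϖ^{m*}𝒪 = valueSetMod σ ϖ m* (e′ • X₊)` (§4 HEAD `exists_fixed_unit_latticeValueSet_eq_smul_xPlus_of_shell`).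
NO band split (RAY ∕ MIX ∕ upper ∕ lower ∕ diagonal alike), NO cone presentation, NO residue-field size, BOTH literals (any `H`).

THE MECHANISM (★ FILE 1 `F0P3cDyRamRankOneSkewValueSet`).  `L = g·𝒪³`, `G = (σg)ᵀHg ∈ GL₃(𝒪)`, `B = g⁻¹Xg` (level `ℓ₀` exactly, `B²` of level `m_c`), `Q = G·B` (the Gram
operator, `⟨gc, X·gc⟩_H = (σc)ᵀQc`).  RANK ONE: `adj B = g⁻¹(adj X)g = B² − (tr X)·B + e₂(X)·1 ∈ ϖ^{m_c}M₃(𝒪)` ⇒ `adj Q = adj B · adj G ∈ ϖ^{m_c}M₃(𝒪)`.  SKEW: `Q + (σQ)ᵀ =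
G·(g⁻¹Γ⁻¹g)·B² ∈ ϖ^{m_c}M₃(𝒪)`.  ONE CLASS (★ `exists_rayScalar_setOf_eq_of_pivotMinors`): `(σy)ᵀQy ≡ e₀·N(a(y)) (mod ϖ^{m_c−ℓ₀})`, `a : 𝒪³ ↠ 𝒪`, `|e₀| = |ϖ|^{ℓ₀}`,
`|e₀ + σe₀| ≤ |ϖ|^{m_c}`; then ★ `exists_fixed_unit_sub_mul_refSkew_le_any` (Eisenstein coordinates, LH4-p16 (g2)) gives a `σ`-fixed unit `e′` with `|e₀ − e′t₊| ≤ |ϖ|^{m*}` and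
★ `valueSetMod_smul_xPlus` ∕ ★ `valueSetMod_smul_xPlus_eq_of_v_sub_le_pred` identify the value set.  Precision: `m_c − ℓ₀ = 3d − 2 ≥ m* = 2d − 1 + ℓ₀` iff `d ≥ 1 + ℓ₀` (every `d ≥ 2`).
* §4 HEAD `exists_fixed_unit_latticeValueSet_eq_smul_xPlus_of_shell` (any `H`, fence = `|tr X|, |e₂ X| ≤ |ϖ|ⁿ`, `n ≥ m_c` — similarity invariants, read in any frame).
* §5 the two literals of ‹OFF.v2› 3abc7da0: `exists_fixed_unit_valueSet_eq_smul_xPlus_of_shell_hyperbolic` (`Φ₃ = block(Φ₂, 1)`, `Γ = endoGL (γ₂, u)`, fence `_hg1`, `_hu1N`) and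
  `exists_fixed_unit_valueSet_eq_smul_xPlus_of_shell_anisotropic` (`block(diag dg, η)`, `Γ′ = endoGL (γ₁, u)` via `_hΓ'`∕`_hA`, fence transported by `_hA12`).
SHARPNESS (data of record).  Below the fence the law fails: LH7-p09 (g2) TYPED-CURRENCY-AUDIT «128 unlabelled clean-shell vertices at `ρ₁₃ = 5 < 8 = m_c`, `d = 3`»; LH4-p13 (g8)
witness `(1 + X₊)·diag(1, β, 1)`, `v(β − 1) = m* − 1 < m_c` (★ `F0P3cDyRamValueSetTwoClassObstruction`).  Both violate exactly the hypothesis `e₂(X), (tr X)·X ∈ ϖ^{m_c}`.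

HONEST LABEL.  Count-neutral lattice algebra; nothing printed is asserted; no census law is stated; (β₂), ‹OFF.v2›'s residue and ‹CORE-REST› stay OPEN with their holders;
`HC_CM` is proved only modulo the 7 printed citations (2 remaining named inputs: hLiu418 = `stmt-HodgeConjecture-24832`, h413 = `stmt-HodgeConjecture-24833`) until rung 0 closes.

## References
* [Rogawski1990] J. D. Rogawski, Ann. of Math. Stud. 123 (1990): §4.9 Prop. 4.9.1 (b) p. 55, §4.8 Case (a) p. 53, §1.10 p. 9; [Kottwitz1986BaseChangeUnits] R. E. Kottwitz, Compositio
  Math. 60 (1986): §1 pp. 240–241, §3; [Jacobowitz1962] R. Jacobowitz, Amer. J. Math. 84 (1962): §4, §7; [Serre1979] J.-P. Serre, *Local Fields*: Ch. I §6 Prop. 18, Ch. V §3 Cor. 3;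
  [Serre1980Trees] J.-P. Serre, *Trees*: Ch. II §1.1.
-/

set_option autoImplicit false

noncomputable section

namespace Summit.HodgeConjecture.HodgeConjecture.Cruxes.H413.F0P3cDyRamCleanShellLabelLaw

open scoped Valued WithZero Matrix MatrixGroups
open WithZero
open Literature.NumberTheory.Automorphic Literature.NumberTheory.Automorphic.HermitianLattice Literature.NumberTheory.Automorphic.UnitaryLatticeTree
open Literature.NumberTheory.Automorphic.UnitaryThreeFourFrame (IsRamifiedQuadraticDatum)
open Summit.HodgeConjecture.HodgeConjecture.Cruxes.H413.F0P3cDyRamFourFramePieces (valueSetMod xPlus mstarOfRecord)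
open Summit.HodgeConjecture.HodgeConjecture.Cruxes.H413.F0P3cDyRamFourFrameCensusDefs (LatticeInLevel LatticeNearTransvShell)
open Summit.HodgeConjecture.HodgeConjecture.Cruxes.H413.F0P3cDyRamStageOneBDefs (mcOfRecord)
open Summit.HodgeConjecture.HodgeConjecture.Cruxes.H413.F0P3cDyRamCleanELetterRamM (exists_fixed_unit_sub_mul_refSkew_le_any)
open Summit.HodgeConjecture.HodgeConjecture.Cruxes.H413.F0P3cDyRamLabelShellFlipCardTwo (v_refSkew_eq valueSetMod_smul_xPlus_eq_of_v_sub_le_pred)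
open Summit.HodgeConjecture.HodgeConjecture.Cruxes.H413.F0P3cDyRamSmulXPlusLabel (valueSetMod_smul_xPlus)
open Summit.HodgeConjecture.HodgeConjecture.Cruxes.H413.F0P3cDyRamRankOneSkewValueSet

/-! ## §4  HEAD — the label law at a self-dual vertex of any hermitian form -/

section Head

variable {K : Type} [Field K] [Valued K ℤᵐ⁰]

/-- **HEAD — «ON THE CLEAN SHELL EVERY VERTEX IS LABELLED `±`» (β₂ WORD #22 (2)), FRAME-FREE.**  `(σ, ϖ, d, t)` a ramified quadratic datum with `2 ≤ d`; `H` hermitian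
(`(σH)ᵀ = H`); `L` a self-dual vertex for `H`; `Γ ∈ U(σ, H)` with `Γ·L = L`; `X = Γ − 1` on the clean shell `LatticeNearTransvShell ϖ (d % 2) (mcOfRecord d) X L`; the fence
`|tr X| ≤ |ϖ|ⁿ`, `|e₂(X)| ≤ |ϖ|ⁿ` (`e₂` = the sum of the principal `2 × 2` minors; both are similarity invariants of `X`, read in ANY frame) with `mcOfRecord d ≤ n`.
THEN for a `σ`-fixed unit `e′`:
`{z | ∃ y ∈ L, |(ϖ^{m*})⁻¹(z − ⟨y, Xy⟩_H)| ≤ 1} = valueSetMod σ ϖ m* (e′ • X₊)`, `m* = mstarOfRecord d` (§1 rank one + skew, §3 one class, ★ Eisenstein coordinates).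
[cite: Rogawski1990, §4.9 Prop. 4.9.1 (b) p. 55] [cite: Kottwitz1986BaseChangeUnits, §1 pp. 240–241; §3] [cite: Jacobowitz1962, §4, §7] [cite: Serre1979, Ch. I §6 Prop. 18; Ch. V §3 Cor. 3] -/
theorem exists_fixed_unit_latticeValueSet_eq_smul_xPlus_of_shell {σ : K →+* K} {ϖ : K} {d t : ℕ} (hD : IsRamifiedQuadraticDatum σ ϖ d t) (hd2 : 2 ≤ d)
    (H : Matrix (Fin 3) (Fin 3) K) (hH : (H.map σ)ᵀ = H) {L : Submodule 𝒪[K] (Fin 3 → K)} (hL : IsSelfDualLattice σ ϖ H L)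
    {Γ : GL (Fin 3) K} (hΓ : Γ ∈ unitaryGroupOfForm σ H) (hfix : mapGL Γ L = L)
    {X : Matrix (Fin 3) (Fin 3) K} (hΓX : (Γ : Matrix (Fin 3) (Fin 3) K) - 1 = X)
    (hsh : LatticeNearTransvShell ϖ (d % 2) (mcOfRecord d) X L)
    {n : ℕ} (hn : mcOfRecord d ≤ n) (htr : Valued.v X.trace ≤ Valued.v ϖ ^ n)
    (he₂ : Valued.v (X 0 0 * X 1 1 + X 0 0 * X 2 2 + X 1 1 * X 2 2 - X 0 1 * X 1 0 - X 0 2 * X 2 0 - X 1 2 * X 2 1) ≤ Valued.v ϖ ^ n) :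
    ∃ e' : K, σ e' = e' ∧ Valued.v e' = 1 ∧
      {z : K | ∃ y ∈ L, Valued.v ((ϖ ^ mstarOfRecord d)⁻¹ * (z - pairing σ H y (X *ᵥ y))) ≤ 1} =
        valueSetMod σ ϖ (mstarOfRecord d) (e' • xPlus σ ϖ d) := by
  subst hΓX
  obtain ⟨hσσ, hvσ, hϖ, -, hdd, hd1, -⟩ := id hD
  have hvϖ0 : Valued.v ϖ ≠ 0 := by rw [hϖ]; exact exp_ne_zero
  have hϖ0 : ϖ ≠ 0 := fun h0 => by rw [h0, map_zero] at hvϖ0; exact hvϖ0 rfl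
  have hϖ1 : Valued.v ϖ ≤ 1 := by rw [hϖ, ← exp_zero, exp_le_exp]; norm_num
  have hpow_le : ∀ {a b : ℕ}, a ≤ b → Valued.v ϖ ^ b ≤ Valued.v ϖ ^ a := fun hab => pow_le_pow_right_of_le_one' hϖ1 hab
  -- the record schedules
  have hms : mstarOfRecord d = d % 2 + 2 * d - 1 := rfl
  have hmc : mcOfRecord d = 3 * d - 2 + d % 2 := by   -- (= ★ `F0P3cDyRamLevKappaSignLawsOfRecord.mc_eq`, re-derived by `omega` to keep the imports light)
    show 2 * ((d % 2 + 2 * d - 1 + d) / 2) = _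
    omega
  set ℓ : ℕ := d % 2 with hℓ
  set P : ℕ := 3 * d - 2 with hP
  have hℓP : ℓ < P := by omega
  have hmcℓP : mcOfRecord d = ℓ + P := by omega
  have hmsP : mstarOfRecord d ≤ P := by omega
  -- the basis `g` of the self-dual vertex and its Gram matrix `G`
  obtain ⟨g, rfl, hGint, -, hGdet⟩ := hL
  rw [pow_zero] at hGdet
  set gm : Matrix (Fin 3) (Fin 3) K := (g : Matrix (Fin 3) (Fin 3) K) with hgm
  set G : Matrix (Fin 3) (Fin 3) K := formCongr σ g H with hG
  have hGdef : G = (gm.map σ)ᵀ * H * gm := by rw [hG, hgm]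
  have hgdet : IsUnit gm.det := Matrix.isUnits_det_units g
  have hginv : ((g⁻¹ : GL (Fin 3) K) : Matrix (Fin 3) (Fin 3) K) = gm⁻¹ := Matrix.coe_units_inv g
  have hcancel : ∀ M : Matrix (Fin 3) (Fin 3) K, gm * (gm⁻¹ * M) = M := fun M => Matrix.mul_nonsing_inv_cancel_left gm M hgdet
  -- the operator in the basis: `B = g⁻¹Xg`
  set X : Matrix (Fin 3) (Fin 3) K := (Γ : Matrix (Fin 3) (Fin 3) K) - 1 with hXdef
  set B : Matrix (Fin 3) (Fin 3) K := gm⁻¹ * X * gm with hB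
  have hBB : B * B = gm⁻¹ * (X * X) * gm := by simp only [hB, Matrix.mul_assoc, hcancel]
  -- (a) the three shell tokens in the basis
  obtain ⟨hsh1, hsh2, hsh3⟩ := hsh
  have tok : ∀ (k : ℕ) (A : Matrix (Fin 3) (Fin 3) K), LatticeInLevel ϖ k A (latt gm) ↔ ∀ i j, Valued.v ((gm⁻¹ * A * gm) i j) ≤ Valued.v (ϖ ^ k) :=
    fun k A => map_toLin'_mapGL_stdLattice_le_scaleLattice_iff (pow_ne_zero k hϖ0) A g
  have hB1 : ∀ i j, Valued.v (B i j) ≤ Valued.v ϖ ^ ℓ := fun i j => by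
    have := (tok ℓ X).1 hsh1 i j; rwa [map_pow] at this
  have hB3 : ∀ i j, Valued.v ((B * B) i j) ≤ Valued.v ϖ ^ (ℓ + P) := fun i j => by
    have := (tok (mcOfRecord d) (X * X)).1 hsh3 i j
    rwa [map_pow, hmcℓP, ← hBB] at this
  -- (b) `Γ·L = L`: `g⁻¹Γ⁻¹g` is integral
  have hT' : ∀ i j, Valued.v ((gm⁻¹ * ((Γ⁻¹ : GL (Fin 3) K) : Matrix (Fin 3) (Fin 3) K) * gm) i j) ≤ 1 := by
    have h2 := ((mapGL_latt_eq_latt_iff Γ g).1 hfix).2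
    intro i j
    have := h2 i j
    rwa [Units.val_mul, Units.val_mul, hginv] at this
  -- (c) the Gram matrix: integral with unit determinant, hence integral inverse and integral adjugate
  have hGint' : ∀ i j, Valued.v (G i j) ≤ 1 := hGint
  have hGinv : ∀ i j, Valued.v (G⁻¹ i j) ≤ 1 := isIntMatrix_nonsing_inv_of_v_det_eq_one hGint hGdet
  have hGadj : ∀ i j, Valued.v (G.adjugate i j) ≤ 1 := CartanUnique.v_adjugate_apply_le_one hGint'
  have hGdetU : IsUnit G.det := by
    rw [isUnit_iff_ne_zero]; intro h0; rw [h0, map_zero] at hGdet; exact zero_ne_one hGdet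
  -- (d) the Gram operator `Q = G·B`
  set Q : Matrix (Fin 3) (Fin 3) K := G * B with hQ
  have hQ0 : ∀ i j, Valued.v (Q i j) ≤ Valued.v ϖ ^ ℓ := fun i j =>
    (v_mul_apply_le hGint' hB1 i j).trans_eq (one_mul _)
  -- some entry of `Q` has exact level `ℓ` (else `B = G⁻¹Q` would have level `ℓ + 1`)
  have hQ1 : ∃ p q, Valued.v (Q p q) = Valued.v ϖ ^ ℓ := by
    by_contra hne
    have hne' : ∀ i j, Valued.v (Q i j) ≠ Valued.v ϖ ^ ℓ := fun i j hij => hne ⟨i, j, hij⟩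
    apply hsh2
    rw [tok (ℓ + 1) X, map_pow]
    have hQ' : ∀ i j, Valued.v (Q i j) ≤ Valued.v ϖ ^ (ℓ + 1) := fun i j =>
      v_le_pow_succ_of_v_lt_pow hϖ (lt_of_le_of_ne (hQ0 i j) (hne' i j))
    have hBQ : B = G⁻¹ * Q := by rw [hQ, Matrix.nonsing_inv_mul_cancel_left G B hGdetU]
    intro i j
    rw [← hB, hBQ]
    exact (v_mul_apply_le hGinv hQ' i j).trans_eq (one_mul _)
  -- (e) RANK ONE: the adjugate of `B`, hence of `Q`, has level `m_c`
  have hadjB : ∀ i j, Valued.v (B.adjugate i j) ≤ Valued.v ϖ ^ (ℓ + P) := by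
    have hconj : B.adjugate = gm⁻¹ * X.adjugate * gm := by
      rw [hB, ← hginv]; exact adjugate_units_conj g X
    have hexp : gm⁻¹ * X.adjugate * gm = B * B - X.trace • B +
        (X 0 0 * X 1 1 + X 0 0 * X 2 2 + X 1 1 * X 2 2 - X 0 1 * X 1 0 - X 0 2 * X 2 0 - X 1 2 * X 2 1) • (1 : Matrix (Fin 3) (Fin 3) K) := by
      rw [adjugate_eq_sq_sub_trace_smul_add X, hBB, hB]
      simp only [Matrix.mul_add, Matrix.mul_sub, Matrix.add_mul, Matrix.sub_mul, Matrix.mul_smul, Matrix.smul_mul, Matrix.mul_one,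
        Matrix.nonsing_inv_mul _ hgdet]
    have hmcn : Valued.v ϖ ^ n ≤ Valued.v ϖ ^ (ℓ + P) := by rw [← hmcℓP]; exact hpow_le hn
    intro i j
    rw [hconj, hexp, Matrix.add_apply, Matrix.sub_apply, Matrix.smul_apply, Matrix.smul_apply, smul_eq_mul, smul_eq_mul]
    refine (Valuation.map_add _ _ _).trans (max_le ((Valuation.map_sub _ _ _).trans (max_le (hB3 i j) ?_)) ?_)
    · rw [map_mul]
      calc Valued.v X.trace * Valued.v (B i j) ≤ Valued.v ϖ ^ n * Valued.v ϖ ^ ℓ := mul_le_mul' htr (hB1 i j)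
        _ ≤ Valued.v ϖ ^ n * 1 := mul_le_mul' le_rfl (pow_le_one₀ (zero_le) hϖ1)
        _ ≤ Valued.v ϖ ^ (ℓ + P) := by rw [mul_one]; exact hmcn
    · rw [map_mul, Matrix.one_apply]
      calc Valued.v (X 0 0 * X 1 1 + X 0 0 * X 2 2 + X 1 1 * X 2 2 - X 0 1 * X 1 0 - X 0 2 * X 2 0 - X 1 2 * X 2 1) *
            Valued.v (if i = j then (1 : K) else 0) ≤ Valued.v ϖ ^ n * 1 := by
            refine mul_le_mul' he₂ ?_
            split_ifs
            · rw [map_one]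
            · rw [map_zero]; exact zero_le
        _ ≤ Valued.v ϖ ^ (ℓ + P) := by rw [mul_one]; exact hmcn
  have hadjQ : ∀ i j, Valued.v (Q.adjugate i j) ≤ Valued.v ϖ ^ (ℓ + P) := fun i j => by
    rw [hQ, Matrix.adjugate_mul_distrib]
    exact (v_mul_apply_le hadjB hGadj i j).trans_eq (mul_one _)
  have hQ2 : ∀ p i j, Valued.v (Q p p * Q i j - Q i p * Q p j) ≤ Valued.v ϖ ^ (ℓ + P) := v_pivotMinor_le_of_adjugate hadjQ
  -- (f) SKEW: `Q + (σQ)ᵀ = G·(g⁻¹Γ⁻¹g)·B²` has level `m_c`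
  have hQ3 : ∀ i j, Valued.v (Q i j + σ (Q j i)) ≤ Valued.v ϖ ^ (ℓ + P) := by
    have hΓU : ((Γ : Matrix (Fin 3) (Fin 3) K).map σ)ᵀ * H * (Γ : Matrix (Fin 3) (Fin 3) K) = H := mem_unitaryGroupOfForm_iff.1 hΓ
    have hΓΓi : (Γ : Matrix (Fin 3) (Fin 3) K) * ((Γ⁻¹ : GL (Fin 3) K) : Matrix (Fin 3) (Fin 3) K) = 1 := by
      rw [← Units.val_mul, mul_inv_cancel, Units.val_one]
    have hskew := gram_add_map_transpose_eq hσσ hH hΓU hΓΓi gm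
    rw [← hXdef] at hskew
    have hQeq : (gm.map σ)ᵀ * H * X * gm = Q := by
      rw [hQ, hGdef, hB]; simp only [Matrix.mul_assoc, hcancel]
    have hprod : (gm.map σ)ᵀ * H * (((Γ⁻¹ : GL (Fin 3) K) : Matrix (Fin 3) (Fin 3) K) * (X * X)) * gm =
        G * (gm⁻¹ * ((Γ⁻¹ : GL (Fin 3) K) : Matrix (Fin 3) (Fin 3) K) * gm) * (B * B) := by
      rw [hGdef, hB]; simp only [Matrix.mul_assoc, hcancel]
    rw [hQeq, hprod] at hskew
    intro i j
    have hij : Q i j + σ (Q j i) = (Q + (Q.map σ)ᵀ) i j := by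
      rw [Matrix.add_apply, Matrix.transpose_apply, Matrix.map_apply]
    rw [hij, hskew]
    calc Valued.v ((G * (gm⁻¹ * ((Γ⁻¹ : GL (Fin 3) K) : Matrix (Fin 3) (Fin 3) K) * gm) * (B * B)) i j)
        ≤ (1 * 1) * Valued.v ϖ ^ (ℓ + P) := v_mul_apply_le (v_mul_apply_le hGint' hT') hB3 i j
      _ = Valued.v ϖ ^ (ℓ + P) := by rw [one_mul, one_mul]
  -- (g) ONE CLASS
  obtain ⟨e₀, he₀, he₀tr, hset⟩ := exists_rayScalar_setOf_eq_of_pivotMinors hσσ hvσ hϖ hℓP hQ0 hQ1 hQ2 hQ3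
  -- (h) the value set at `L = g·𝒪³` in the basis
  have hVS : {z : K | ∃ y ∈ latt gm, Valued.v ((ϖ ^ mstarOfRecord d)⁻¹ * (z - pairing σ H y (X *ᵥ y))) ≤ 1} =
      {z : K | ∃ c : Fin 3 → K, (∀ i, Valued.v (c i) ≤ 1) ∧
        Valued.v ((ϖ ^ mstarOfRecord d)⁻¹ * (z - ∑ i, ∑ j, σ (c i) * Q i j * c j)) ≤ 1} := by
    have hXg : ∀ c : Fin 3 → K, X *ᵥ (gm *ᵥ c) = gm *ᵥ (B *ᵥ c) := fun c => by
      rw [Matrix.mulVec_mulVec, Matrix.mulVec_mulVec]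
      congr 1
      simp only [hB, Matrix.mul_assoc, hcancel]
    have hval : ∀ c : Fin 3 → K, pairing σ H (gm *ᵥ c) (X *ᵥ (gm *ᵥ c)) = ∑ i, ∑ j, σ (c i) * Q i j * c j := fun c => by
      rw [hXg, hQ, hG, hgm, pairing_mulVec_mulVec, pairing_mulVec_right, pairing_apply]
    ext z
    simp only [Set.mem_setOf_eq]
    constructor
    · rintro ⟨y, hy, hz⟩
      obtain ⟨c, hc, rfl⟩ := Submodule.mem_map.1 hy
      refine ⟨c, fun i => (mem_stdLattice.1 hc) i, ?_⟩
      rw [LinearMap.restrictScalars_apply, Matrix.toLin'_apply, hval] at hz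
      exact hz
    · rintro ⟨c, hc, hz⟩
      refine ⟨gm *ᵥ c, mulVec_mem_latt gm (mem_stdLattice.2 hc), ?_⟩
      rw [hval]; exact hz
  -- (i) Eisenstein coordinates: `e₀ = e′·t₊ + O(ϖ^{m*})` for a fixed unit `e′`
  have he₀ℓ : Valued.v e₀ = Valued.v ϖ ^ (d % 2) := he₀
  have htr' : Valued.v (e₀ + σ e₀) ≤ Valued.v ϖ ^ ((2 * d - 1) + d - 1 + d % 2) :=
    he₀tr.trans (le_of_eq (by congr 1; omega))
  obtain ⟨e', he'σ, he'1, hclose⟩ := exists_fixed_unit_sub_mul_refSkew_le_any hD (N := 2 * d - 1) (by omega) he₀ℓ htr'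
  refine ⟨e', he'σ, he'1, ?_⟩
  rw [hVS, hset (mstarOfRecord d) hmsP]
  -- (j) the ray `a ↦ e₀·N(a)` is the letter of `(e₀∕t₊) • X₊`, and `e₀∕t₊ ≡ e′ (mod ϖ^{2d−1})`
  have hvt : Valued.v ((ϖ - σ ϖ) * ((ϖ * σ ϖ) ^ ((d - d % 2) / 2))⁻¹) = Valued.v ϖ ^ (d % 2) := v_refSkew_eq hvσ hϖ hdd
  set tp : K := (ϖ - σ ϖ) * ((ϖ * σ ϖ) ^ ((d - d % 2) / 2))⁻¹ with htp
  have htp0 : tp ≠ 0 := fun h0 => by rw [h0, map_zero] at hvt; exact pow_ne_zero _ hvϖ0 hvt.symm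
  have hray : {z : K | ∃ a : K, Valued.v a ≤ 1 ∧ Valued.v ((ϖ ^ mstarOfRecord d)⁻¹ * (z - e₀ * (a * σ a))) ≤ 1} =
      valueSetMod σ ϖ (mstarOfRecord d) ((e₀ * tp⁻¹) • xPlus σ ϖ d) := by
    have hsc : ∀ a : K, e₀ * tp⁻¹ * (tp * (a * σ a)) = e₀ * (a * σ a) := fun a => by
      rw [mul_assoc, inv_mul_cancel_left₀ htp0]
    rw [valueSetMod_smul_xPlus]
    simp_rw [← htp, hsc]
  rw [hray]
  have hge : Valued.v (e₀ * tp⁻¹ - e') ≤ Valued.v ϖ ^ (2 * d - 1) := by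
    have e : e₀ * tp⁻¹ - e' = tp⁻¹ * (e₀ - e' * tp) := by field_simp
    rw [e, Valuation.map_mul, map_inv₀, hvt, inv_mul_le_iff₀ (pow_pos (zero_lt_iff.2 hvϖ0) _), ← pow_add]
    exact hclose.trans (le_of_eq (by rw [add_comm]))
  exact valueSetMod_smul_xPlus_eq_of_v_sub_le_pred hvσ hϖ hdd (show mstarOfRecord d ≤ (2 * d - 1) + d % 2 by rw [hms]; omega) hge

end Head

/-! ## §5  The two literals of ‹OFF.v2› (β₂ WORD #22 (2)): `Γ = endoGL (γ₂, u)` for `Φ₃ = block(Φ₂, 1)` (hyperbolic literal) and `Γ′ = endoGL (γ₁, u)` for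
`block(diag dg, η)` (anisotropic literal); the fence is read off `γ₂ ≡ 1`, `u ≡ 1 (mod ϖ^N)` (`_hg1`, `_hu1N`) and transported to `γ₁` by `_hA12` (same characteristic polynomial) -/

section Literals

open Literature.NumberTheory.Rogawski1990
open Literature.NumberTheory.LocalFields.WildQuadraticDatum (two_le_of_v_two_lt_one)

variable {E : Type} [Field E] [Valued E ℤᵐ⁰]

omit [Valued E ℤᵐ⁰] in
/-- **THE SIMILARITY INVARIANTS OF `X = endoGL (γ, u) − 1`**: `tr X = (tr γ − 2) + (u − 1)` and `e₂(X) = (u − 1)·(tr γ − 2) + (det γ − tr γ + 1)` (the printed picture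
`(a 0 b; 0 u 0; c 0 d)` of ★ `coe_endoGL_eq`). [cite: Rogawski1990, §4.8 Case (a) p. 53] -/
theorem trace_and_e₂_endoGL_sub_one (γ : GL (Fin 2) E) (u : GL (Fin 1) E) {X : Matrix (Fin 3) (Fin 3) E}
    (hX : ((endoGL (γ, u) : GL (Fin 3) E) : Matrix (Fin 3) (Fin 3) E) - 1 = X) :
    X.trace = ((γ : Matrix (Fin 2) (Fin 2) E).trace - 2) + (((u : Matrix (Fin 1) (Fin 1) E) 0 0) - 1) ∧
    X 0 0 * X 1 1 + X 0 0 * X 2 2 + X 1 1 * X 2 2 - X 0 1 * X 1 0 - X 0 2 * X 2 0 - X 1 2 * X 2 1 =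
      ((((u : Matrix (Fin 1) (Fin 1) E) 0 0) - 1) * ((γ : Matrix (Fin 2) (Fin 2) E).trace - 2) +
        ((γ : Matrix (Fin 2) (Fin 2) E).det - (γ : Matrix (Fin 2) (Fin 2) E).trace + 1)) := by
  subst hX
  rw [coe_endoGL_eq, Matrix.trace_fin_three, Matrix.trace_fin_two, Matrix.det_fin_two]
  constructor <;> (simp; ring)

/-- **THE FENCE OF THE PLANE BLOCK**: `|γ_ij − δ_ij| ≤ |ϖ|ⁿ` ⟹ `|tr γ − 2| ≤ |ϖ|ⁿ` and `|det γ − tr γ + 1| = |det(γ − 1)| ≤ |ϖ|ⁿ` (`|ϖ| ≤ 1`). [cite: Kottwitz1986BaseChangeUnits, §3] -/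
theorem v_trace_det_of_near_one {ϖ : E} (hϖ1 : Valued.v ϖ ≤ 1) {n : ℕ} {γ : Matrix (Fin 2) (Fin 2) E}
    (hg1 : ∀ i j, Valued.v (γ i j - (1 : Matrix (Fin 2) (Fin 2) E) i j) ≤ Valued.v (ϖ ^ n)) :
    Valued.v (γ.trace - 2) ≤ Valued.v ϖ ^ n ∧ Valued.v (γ.det - γ.trace + 1) ≤ Valued.v ϖ ^ n := by
  have h00 := hg1 0 0; have h01 := hg1 0 1; have h10 := hg1 1 0; have h11 := hg1 1 1
  simp only [Matrix.one_apply_eq, map_pow] at h00 h11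
  rw [Matrix.one_apply_ne (by decide), sub_zero, map_pow] at h01 h10
  have hn2 : Valued.v ϖ ^ n * Valued.v ϖ ^ n ≤ Valued.v ϖ ^ n := (mul_le_mul' (pow_le_one₀ zero_le hϖ1) le_rfl).trans_eq (one_mul _)
  rw [Matrix.trace_fin_two, Matrix.det_fin_two]
  constructor
  · have e : γ 0 0 + γ 1 1 - 2 = (γ 0 0 - 1) + (γ 1 1 - 1) := by ring
    rw [e]; exact (Valuation.map_add _ _ _).trans (max_le h00 h11)
  · have e : γ 0 0 * γ 1 1 - γ 0 1 * γ 1 0 - (γ 0 0 + γ 1 1) + 1 = (γ 0 0 - 1) * (γ 1 1 - 1) - γ 0 1 * γ 1 0 := by ring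
    rw [e]
    refine (Valuation.map_sub _ _ _).trans (max_le ?_ ?_)
    · rw [map_mul]; exact (mul_le_mul' h00 h11).trans hn2
    · rw [map_mul]; exact (mul_le_mul' h01 h10).trans hn2

/-- **THE FENCE OF `X = endoGL (γ, u) − 1` FROM THE INVARIANTS OF `γ` AND `u`**: `|tr γ − 2|, |det γ − tr γ + 1|, |u − 1| ≤ |ϖ|ⁿ` ⟹ `|tr X|, |e₂(X)| ≤ |ϖ|ⁿ`.
[cite: Rogawski1990, §4.8 Case (a) p. 53] [cite: Kottwitz1986BaseChangeUnits, §3] -/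
theorem fence_endoGL_sub_one {ϖ : E} (hϖ1 : Valued.v ϖ ≤ 1) {n : ℕ} (γ : GL (Fin 2) E) (u : GL (Fin 1) E)
    (htr : Valued.v ((γ : Matrix (Fin 2) (Fin 2) E).trace - 2) ≤ Valued.v ϖ ^ n)
    (hdet : Valued.v ((γ : Matrix (Fin 2) (Fin 2) E).det - (γ : Matrix (Fin 2) (Fin 2) E).trace + 1) ≤ Valued.v ϖ ^ n)
    (hu1 : Valued.v (((u : Matrix (Fin 1) (Fin 1) E) 0 0) - 1) ≤ Valued.v ϖ ^ n)
    {X : Matrix (Fin 3) (Fin 3) E} (hX : ((endoGL (γ, u) : GL (Fin 3) E) : Matrix (Fin 3) (Fin 3) E) - 1 = X) :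
    Valued.v X.trace ≤ Valued.v ϖ ^ n ∧
    Valued.v (X 0 0 * X 1 1 + X 0 0 * X 2 2 + X 1 1 * X 2 2 - X 0 1 * X 1 0 - X 0 2 * X 2 0 - X 1 2 * X 2 1) ≤ Valued.v ϖ ^ n := by
  obtain ⟨htrX, he₂X⟩ := trace_and_e₂_endoGL_sub_one γ u hX
  have hn2 : Valued.v ϖ ^ n * Valued.v ϖ ^ n ≤ Valued.v ϖ ^ n := (mul_le_mul' (pow_le_one₀ zero_le hϖ1) le_rfl).trans_eq (one_mul _)
  rw [htrX, he₂X]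
  refine ⟨(Valuation.map_add _ _ _).trans (max_le htr hu1), (Valuation.map_add _ _ _).trans (max_le ?_ hdet)⟩
  rw [map_mul]; exact (mul_le_mul' hu1 htr).trans hn2

omit [Valued E ℤᵐ⁰] in
/-- Two `2 × 2` matrices with the same characteristic polynomial have the same trace and determinant. [folklore] -/
theorem trace_det_eq_of_charpoly_eq {γ₁ γ₂ : Matrix (Fin 2) (Fin 2) E} (h : γ₁.charpoly = γ₂.charpoly) :
    γ₁.trace = γ₂.trace ∧ γ₁.det = γ₂.det := by
  constructor
  · rw [Matrix.trace_eq_neg_charpoly_coeff, Matrix.trace_eq_neg_charpoly_coeff, h]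
  · rw [Matrix.det_eq_sign_charpoly_coeff, Matrix.det_eq_sign_charpoly_coeff, h]

/-- **LITERAL 1 (HYPERBOLIC): «ON THE CLEAN SHELL EVERY VERTEX OF THE `h`-LITERAL IS LABELLED `±`»**, in ‹OFF.v2›'s letters (binders a subset BY NAME AND BYTE of its general block,
with the fence exponent `n := N d tE (Nat.card 𝓀[E])` and the holder's floor `mcOfRecord d ≤ n`): for every self-dual `L₃` of the block form `Φ₃ = block(Φ₂, 1)` fixed by
`Γ = endoGL (γ₂, u)` with `Γ − 1` on the clean shell `(d % 2, mcOfRecord d)`, `VS_{m*}(L₃) = valueSetMod σ ϖ (mstarOfRecord d) (e′ • xPlus σ ϖ d)` for a `σ`-fixed unit `e′`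
(§4 HEAD; the fence from `_hg1`, `_hu1N`; `2 ≤ d` from `_h2`). [cite: Rogawski1990, §4.9 Prop. 4.9.1 (b) p. 55] [cite: Kottwitz1986BaseChangeUnits, §1 pp. 240–241] [cite: Jacobowitz1962, §4, §7] -/
theorem exists_fixed_unit_valueSet_eq_smul_xPlus_of_shell_hyperbolic
    (σ : E →+* E) (ϖ : E) (d tE : ℕ) (_hD : IsRamifiedQuadraticDatum σ ϖ d tE) (_h2 : ¬ IsUnit (2 : 𝒪[E]))
    (γ₂ : GL (Fin 2) E) (u : GL (Fin 1) E) {n : ℕ} (hn : mcOfRecord d ≤ n)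
    (_hu1N : Valued.v (((u : Matrix (Fin 1) (Fin 1) E) 0 0) - 1) ≤ Valued.v (ϖ ^ n))
    (_hg1 : ∀ i j, Valued.v ((γ₂ : Matrix (Fin 2) (Fin 2) E) i j - (1 : Matrix (Fin 2) (Fin 2) E) i j) ≤ Valued.v (ϖ ^ n))
    (_hΓ : endoGL (γ₂, u) ∈ unitaryGroupOfForm σ ((StdForm.antidiagonal 3).over E))
    {L₃ : Submodule 𝒪[E] (Fin 3 → E)}
    (hL₃ : IsSelfDualLattice σ ϖ (!![((StdForm.antidiagonal 2).over E) 0 0, 0, ((StdForm.antidiagonal 2).over E) 0 1; 0, (1 : E), 0; ((StdForm.antidiagonal 2).over E) 1 0, 0, ((StdForm.antidiagonal 2).over E) 1 1] : Matrix (Fin 3) (Fin 3) E) L₃)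
    (hΓL₃ : mapGL (endoGL (γ₂, u)) L₃ = L₃)
    (hshell : LatticeNearTransvShell ϖ (d % 2) (mcOfRecord d) ((((endoGL (γ₂, u) : GL (Fin 3) E) : Matrix (Fin 3) (Fin 3) E) - 1)) L₃) :
    ∃ e' : E, σ e' = e' ∧ Valued.v e' = 1 ∧
      {z : E | ∃ y ∈ L₃, Valued.v ((ϖ ^ (mstarOfRecord d))⁻¹ * (z - pairing σ (!![((StdForm.antidiagonal 2).over E) 0 0, 0, ((StdForm.antidiagonal 2).over E) 0 1; 0, (1 : E), 0; ((StdForm.antidiagonal 2).over E) 1 0, 0, ((StdForm.antidiagonal 2).over E) 1 1] : Matrix (Fin 3) (Fin 3) E) y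
          (((((endoGL (γ₂, u) : GL (Fin 3) E) : Matrix (Fin 3) (Fin 3) E) - 1)) *ᵥ y))) ≤ 1} =
        valueSetMod σ ϖ (mstarOfRecord d) (e' • xPlus σ ϖ d) := by
  obtain ⟨hσσ, hvσ, hϖ, hfix, hdd, -, ht⟩ := id _hD
  have hϖ1 : Valued.v ϖ ≤ 1 := by rw [hϖ, ← exp_zero, exp_le_exp]; norm_num
  have h2v : Valued.v (2 : E) < 1 := by exact_mod_cast Valuation.Integer.not_isUnit_iff_valuation_lt_one.mp _h2
  have hd2 : 2 ≤ d := two_le_of_v_two_lt_one hσσ hvσ hfix hϖ hdd ht h2v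
  have hHeq : (!![((StdForm.antidiagonal 2).over E) 0 0, 0, ((StdForm.antidiagonal 2).over E) 0 1; 0, (1 : E), 0; ((StdForm.antidiagonal 2).over E) 1 0, 0, ((StdForm.antidiagonal 2).over E) 1 1] : Matrix (Fin 3) (Fin 3) E) = (StdForm.antidiagonal 3).over E := by
    ext i j; fin_cases i <;> fin_cases j <;> simp [StdForm.over, StdForm.antidiagonal_J_apply, Fin.rev]
  have hH : ((!![((StdForm.antidiagonal 2).over E) 0 0, 0, ((StdForm.antidiagonal 2).over E) 0 1; 0, (1 : E), 0; ((StdForm.antidiagonal 2).over E) 1 0, 0, ((StdForm.antidiagonal 2).over E) 1 1] : Matrix (Fin 3) (Fin 3) E).map σ)ᵀ = (!![((StdForm.antidiagonal 2).over E) 0 0, 0, ((StdForm.antidiagonal 2).over E) 0 1; 0, (1 : E), 0; ((StdForm.antidiagonal 2).over E) 1 0, 0, ((StdForm.antidiagonal 2).over E) 1 1] : Matrix (Fin 3) (Fin 3) E) := by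
    ext i j; fin_cases i <;> fin_cases j <;> simp [StdForm.over, StdForm.antidiagonal_J_apply, Fin.rev]
  have hΓ : endoGL (γ₂, u) ∈ unitaryGroupOfForm σ (!![((StdForm.antidiagonal 2).over E) 0 0, 0, ((StdForm.antidiagonal 2).over E) 0 1; 0, (1 : E), 0; ((StdForm.antidiagonal 2).over E) 1 0, 0, ((StdForm.antidiagonal 2).over E) 1 1] : Matrix (Fin 3) (Fin 3) E) := by rw [hHeq]; exact _hΓ
  obtain ⟨htr2, hdet2⟩ := v_trace_det_of_near_one hϖ1 _hg1
  have hu1 : Valued.v (((u : Matrix (Fin 1) (Fin 1) E) 0 0) - 1) ≤ Valued.v ϖ ^ n := by rw [map_pow] at _hu1N; exact _hu1N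
  obtain ⟨htrX, he₂X⟩ := fence_endoGL_sub_one hϖ1 γ₂ u htr2 hdet2 hu1 rfl
  exact exists_fixed_unit_latticeValueSet_eq_smul_xPlus_of_shell _hD hd2 _ hH hL₃ hΓ hΓL₃ rfl hshell hn htrX he₂X

/-- **LITERAL 2 (ANISOTROPIC): «ON THE CLEAN SHELL EVERY VERTEX OF THE `h′`-LITERAL IS LABELLED `±`»**, in ‹OFF.v2›'s letters: the form `block(diag dg, η)` (`σ`-fixed entries
`_hdgσ`, `_hησ`), `Γ′ = endoGL (γ₁, u)` unitary for it through `_hΓ'`∕`_hA` (★ `conj_mem_unitaryGroupOfForm_iff`), and the fence transported from `γ₂` to `γ₁` by `_hA12` (same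
trace and determinant); conclusion `VS′_{m*}(L₃) = valueSetMod σ ϖ (mstarOfRecord d) (e′ • xPlus σ ϖ d)` for a `σ`-fixed unit `e′` (§4 HEAD).
[cite: Rogawski1990, §4.9 Prop. 4.9.1 (b) p. 55] [cite: Kottwitz1986BaseChangeUnits, §1 pp. 240–241] [cite: Jacobowitz1962, §4, §7] -/
theorem exists_fixed_unit_valueSet_eq_smul_xPlus_of_shell_anisotropic
    (σ : E →+* E) (ϖ : E) (d tE : ℕ) (_hD : IsRamifiedQuadraticDatum σ ϖ d tE) (_h2 : ¬ IsUnit (2 : 𝒪[E]))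
    (γ₂ : GL (Fin 2) E) (u : GL (Fin 1) E) {n : ℕ} (hn : mcOfRecord d ≤ n)
    (_hu1N : Valued.v (((u : Matrix (Fin 1) (Fin 1) E) 0 0) - 1) ≤ Valued.v (ϖ ^ n))
    (_hg1 : ∀ i j, Valued.v ((γ₂ : Matrix (Fin 2) (Fin 2) E) i j - (1 : Matrix (Fin 2) (Fin 2) E) i j) ≤ Valued.v (ϖ ^ n))
    (P₁ : GL (Fin 3) E) (dg : Fin 2 → E) (η : E) (γ₁ : GL (Fin 2) E)
    (_hΓ' : P₁ * endoGL (γ₁, u) * P₁⁻¹ ∈ unitaryGroupOfForm σ ((StdForm.antidiagonal 3).over E))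
    (_hA : formCongr σ P₁ ((StdForm.antidiagonal 3).over E) = (!![(Matrix.diagonal dg) 0 0, 0, (Matrix.diagonal dg) 0 1; 0, η, 0; (Matrix.diagonal dg) 1 0, 0, (Matrix.diagonal dg) 1 1] : Matrix (Fin 3) (Fin 3) E))
    (_hdgσ : ∀ i, σ (dg i) = dg i) (_hησ : σ η = η)
    (_hA12 : (γ₁ : Matrix (Fin 2) (Fin 2) E).charpoly = (γ₂ : Matrix (Fin 2) (Fin 2) E).charpoly)
    {L₃ : Submodule 𝒪[E] (Fin 3 → E)}
    (hL₃ : IsSelfDualLattice σ ϖ (!![(Matrix.diagonal dg) 0 0, 0, (Matrix.diagonal dg) 0 1; 0, η, 0; (Matrix.diagonal dg) 1 0, 0, (Matrix.diagonal dg) 1 1] : Matrix (Fin 3) (Fin 3) E) L₃)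
    (hΓL₃ : mapGL (endoGL (γ₁, u)) L₃ = L₃)
    (hshell : LatticeNearTransvShell ϖ (d % 2) (mcOfRecord d) ((((endoGL (γ₁, u) : GL (Fin 3) E) : Matrix (Fin 3) (Fin 3) E) - 1)) L₃) :
    ∃ e' : E, σ e' = e' ∧ Valued.v e' = 1 ∧
      {z : E | ∃ y ∈ L₃, Valued.v ((ϖ ^ (mstarOfRecord d))⁻¹ * (z - pairing σ (!![(Matrix.diagonal dg) 0 0, 0, (Matrix.diagonal dg) 0 1; 0, η, 0; (Matrix.diagonal dg) 1 0, 0, (Matrix.diagonal dg) 1 1] : Matrix (Fin 3) (Fin 3) E) y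
          (((((endoGL (γ₁, u) : GL (Fin 3) E) : Matrix (Fin 3) (Fin 3) E) - 1)) *ᵥ y))) ≤ 1} =
        valueSetMod σ ϖ (mstarOfRecord d) (e' • xPlus σ ϖ d) := by
  obtain ⟨hσσ, hvσ, hϖ, hfix, hdd, -, ht⟩ := id _hD
  have hϖ1 : Valued.v ϖ ≤ 1 := by rw [hϖ, ← exp_zero, exp_le_exp]; norm_num
  have h2v : Valued.v (2 : E) < 1 := by exact_mod_cast Valuation.Integer.not_isUnit_iff_valuation_lt_one.mp _h2
  have hd2 : 2 ≤ d := two_le_of_v_two_lt_one hσσ hvσ hfix hϖ hdd ht h2v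
  have hH : ((!![(Matrix.diagonal dg) 0 0, 0, (Matrix.diagonal dg) 0 1; 0, η, 0; (Matrix.diagonal dg) 1 0, 0, (Matrix.diagonal dg) 1 1] : Matrix (Fin 3) (Fin 3) E).map σ)ᵀ = (!![(Matrix.diagonal dg) 0 0, 0, (Matrix.diagonal dg) 0 1; 0, η, 0; (Matrix.diagonal dg) 1 0, 0, (Matrix.diagonal dg) 1 1] : Matrix (Fin 3) (Fin 3) E) := by
    ext i j; fin_cases i <;> fin_cases j <;> simp [Matrix.diagonal, _hdgσ, _hησ]
  have hΓ : endoGL (γ₁, u) ∈ unitaryGroupOfForm σ (!![(Matrix.diagonal dg) 0 0, 0, (Matrix.diagonal dg) 0 1; 0, η, 0; (Matrix.diagonal dg) 1 0, 0, (Matrix.diagonal dg) 1 1] : Matrix (Fin 3) (Fin 3) E) := by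
    rw [← _hA]; exact (conj_mem_unitaryGroupOfForm_iff σ P₁ _ _).1 _hΓ'
  obtain ⟨htr2, hdet2⟩ := v_trace_det_of_near_one hϖ1 _hg1
  obtain ⟨htr12, hdet12⟩ := trace_det_eq_of_charpoly_eq _hA12
  rw [← htr12] at htr2
  rw [← htr12, ← hdet12] at hdet2
  have hu1 : Valued.v (((u : Matrix (Fin 1) (Fin 1) E) 0 0) - 1) ≤ Valued.v ϖ ^ n := by rw [map_pow] at _hu1N; exact _hu1N
  obtain ⟨htrX, he₂X⟩ := fence_endoGL_sub_one hϖ1 γ₁ u htr2 hdet2 hu1 rfl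
  exact exists_fixed_unit_latticeValueSet_eq_smul_xPlus_of_shell _hD hd2 _ hH hL₃ hΓ hΓL₃ rfl hshell hn htrX he₂X

end Literals

end Summit.HodgeConjecture.HodgeConjecture.Cruxes.H413.F0P3cDyRamCleanShellLabelLaw

end
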